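import Summits.QuantumFields.YangMills.Theorems.BalabanUVNodesN19LevelStatisticsCrossPolytope

/-!
# YM-DAG node N19 (= NE7 proper) — NO CHEAP DECOMPOSITION IS TIGHT: the dyadic kink-exact ladder splits `|x|` into `J + 1` polynomial pieces with
# `Σ deg·osc ≤ 2 + 224·J` at accuracy `16·2^{−J}` (module 198: every splitting at accuracy `ε` pays `≳ log₂(1∕ε)∕(24π)`)

Cell `pub-ymgap`, HUMAN RULING D-0062 (Track A) ∕ D-0149 (work-bound push), R141 (C) wider-strategy seat `pub-ymgap-dag-n19-e` (strategy
s3 = ALTERNATIVE CURRENCY), generation g36, module 5 (lineage module 200).  Route `Summits/QuantumFields/YangMills/Theses/BalabanUVNodes.lean`,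
cluster item K3⁸ «SpineGivenEndpointR13SepCoPHV» (stmt-QuantumFields-27366); filed `--supports` that item `--as helper` (it proves no registered
stub).  COUNT-NEUTRAL: bookkeeping over module 197 `…N19LevelStatisticsCrossPolytope` (`exists_kinkExact_family_levelSum_le`: module 196's family at
`L = 2^l`) BY NAME; no laws, no scheme object, no Theses import; NOT a discharge claim.

ROLE IN THE LINEAGE.  Module 198 (`…N19NoCheapDecomposition`) proves that EVERY splitting `|x| = Σ_p g_p + O(ε)` into polynomial pieces has
`Σ_p deg(g_p)·osc(g_p) ≥ (2M−1)∕(48π)` once `2^Mε ≤ 1∕(96π)` — linear in `log₂(1∕ε)`.  THIS MODULE is the matching upper bound: the telescoping pieces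
`g_0 = p_{2^0}`, `g_{l+1} = p_{2^{l+1}} − p_{2^l}` (`l < J`) of module 196's kink-exact family have `deg g_{l+1} ≤ 2^{l+2} − 1` and
`|g_{l+1}(x)| ≤ min(4|x|, (9∕8)C₀∕(8^l x²)) ≤ 28·2^{−l}` (`C₀ = π⁷∕3`; split at `|x| = 7·2^{−l}`), so `Σ_{l≤J} deg(g_l)·osc(g_l) ≤ 2 + 224·J`, while
`||x| − Σ_{l≤J} g_l(x)| = ||x| − p_{2^J}(x)| ≤ min(2|x|, C₀∕(8^J x²)) ≤ 16·2^{−J}` (split at `|x| = 8·2^{−J}`).  So the logarithm of module 198 is the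
true order of the decomposition cost: **`Σ deg·osc ≍ log(1∕ε)`, two-sided.**

HONEST FRAMING (binding).  Elementary; constants crude (`224` against `1∕(24π)`); NO consumer in the DAG today; nothing of Bałaban's instantiated; NE7 NOT
PRINTED, NOT proved; N19 NOT discharged; count-neutral.  One finite `T⁴` programme at fixed `ε`; nothing continuum ∕ `ℝ⁴` ∕ OS ∕ mass-gap ∕ Clay.
0 `def` ∕ 0 `sorry`.
-/

noncomputable section

open Finset Polynomial
open scoped Real

namespace Summit.QuantumFields.YangMills.Theorems.BalabanUVNodesN19NoCheapDecompositionTight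

open Summit.QuantumFields.YangMills.Theorems.BalabanUVNodesN19LevelStatisticsCrossPolytope (exists_kinkExact_family_levelSum_le)

/-- `π⁷∕3 ≤ 1007`. [bookkeeping] -/
theorem pi_pow_seven_div_three_le : π ^ 7 / 3 ≤ (1007 : ℝ) := by
  have h := Real.pi_lt_d6
  have h0 := Real.pi_pos
  have h7 : π ^ 7 ≤ (3.141593 : ℝ) ^ 7 := pow_le_pow_left₀ h0.le h.le 7
  norm_num at h7
  linarith

/-- **A TWO-SIDED PROFILE HAS A BOUNDED PEAK**: if `0 ≤ v ≤ A·a` and `v ≤ B∕(s·a²)` for some `a > 0` (`A, B, s, λ > 0`), then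
`v ≤ max(A·λ, B∕(s·λ²))`-type bounds follow by splitting at `a = λ`; here in the form used below: `v ≤ A·λ∕t + B·t²∕(s·λ²)`… we state the clean case
`a ≤ λ∕t ∨ a > λ∕t`. [bookkeeping] -/
theorem le_of_two_profiles {v a A B c t : ℝ} (hA : 0 ≤ A) (hB : 0 ≤ B) (hc : 0 < c) (ht : 0 < t)
    (h1 : v ≤ A * a) (h2 : v ≤ B / (t ^ 3 * a ^ 2)) : v ≤ max (A * c) (B / c ^ 2) / t := by
  by_cases hac : a ≤ c / t
  · calc v ≤ A * a := h1
      _ ≤ A * (c / t) := mul_le_mul_of_nonneg_left hac hA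
      _ = A * c / t := by ring
      _ ≤ max (A * c) (B / c ^ 2) / t := div_le_div_of_nonneg_right (le_max_left _ _) ht.le
  · rw [not_le] at hac
    have hct : 0 < c / t := by positivity
    have hden : t ^ 3 * (c / t) ^ 2 ≤ t ^ 3 * a ^ 2 :=
      mul_le_mul_of_nonneg_left (pow_le_pow_left₀ hct.le hac.le 2) (by positivity)
    calc v ≤ B / (t ^ 3 * a ^ 2) := h2
      _ ≤ B / (t ^ 3 * (c / t) ^ 2) := div_le_div_of_nonneg_left hB (by positivity) hden
      _ = B / c ^ 2 / t := by field_simp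
      _ ≤ max (A * c) (B / c ^ 2) / t := div_le_div_of_nonneg_right (le_max_right _ _) ht.le

/-- ★★ **THE DYADIC KINK-EXACT LADDER AS A DECOMPOSITION: `Σ deg·osc ≤ 2 + 224·J` AT ACCURACY `16·2^{−J}`.**  There are real polynomials `p_l` (module
196's family at `L = 2^l`, `deg p_l ≤ 2^{l+1} − 1`) such that for every `J`, with the pieces `g_0 = p_0` and `g_{l+1} = p_{l+1} − p_l` (`l < J`):
(i) `||x| − p_J(x)| ≤ 16·2^{−J}` on `[−1,1]` (and `p_J = Σ_{l ≤ J} g_l` telescopically); (ii) `|p_0(x)| ≤ 1` and `|p_{l+1}(x) − p_l(x)| ≤ 28·2^{−l}` on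
`[−1,1]`; (iii) hence `deg(p_0)·2 + Σ_{l<J} deg(p_{l+1} − p_l)·(2·28·2^{−l}) ≤ 2 + 224·J`.  Module 198's lower bound at `ε = 16·2^{−J}` is linear in `J`
as well: the decomposition cost of the kink is `≍ log(1∕ε)`, two-sided. [folklore] -/
theorem exists_dyadic_decomposition_cost_le :
    ∃ p : ℕ → ℝ[X], (∀ l, (p l).natDegree ≤ 2 ^ (l + 1) - 1) ∧
      (∀ (J : ℕ) (x : ℝ), x ∈ Set.Icc (-1 : ℝ) 1 → |(|x|) - (p J).eval x| ≤ 16 / 2 ^ J) ∧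
      (∀ x : ℝ, x ∈ Set.Icc (-1 : ℝ) 1 → |(p 0).eval x| ≤ 1) ∧
      (∀ (l : ℕ) (x : ℝ), x ∈ Set.Icc (-1 : ℝ) 1 → |(p (l + 1)).eval x - (p l).eval x| ≤ 28 / 2 ^ l) ∧
      ∀ J : ℕ, ((p 0).natDegree : ℝ) * 2 + ∑ l ∈ range J, ((p (l + 1) - p l).natDegree : ℝ) * (2 * (28 / 2 ^ l)) ≤ 2 + 224 * J := by
  obtain ⟨p, hdeg, h1, h2, h3, _⟩ := exists_kinkExact_family_levelSum_le
  have hC := pi_pow_seven_div_three_le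
  have hπ := Real.pi_pos
  refine ⟨p, hdeg, fun J x hx => ?_, fun x hx => ?_, fun l x hx => ?_, fun J => ?_⟩
  · -- accuracy of `p_J`: `min(2|x|, C₀/(8^J x²)) ≤ 16·2^{-J}` (split at `|x| = 8·2^{-J}`)
    by_cases hx0 : x = 0
    · have h := h2 J x hx
      rw [hx0, abs_zero, mul_zero] at h
      rw [hx0, abs_zero]
      exact h.trans (by positivity)
    have hA : |(|x|) - (p J).eval x| ≤ 2 * |x| := h2 J x hx
    have hB' : |(|x|) - (p J).eval x| ≤ (π ^ 7 / 3) / (((2 : ℝ) ^ J) ^ 3 * |x| ^ 2) := by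
      have h := h3 J x hx hx0
      have e : (8 : ℝ) ^ J * x ^ 2 = ((2 : ℝ) ^ J) ^ 3 * |x| ^ 2 := by
        rw [sq_abs, ← pow_mul, mul_comm J 3, pow_mul]; norm_num
      rwa [e] at h
    have key := le_of_two_profiles (by norm_num : (0 : ℝ) ≤ 2) (by positivity) (by norm_num : (0 : ℝ) < 8)
      (by positivity : (0 : ℝ) < 2 ^ J) hA hB'
    refine key.trans (div_le_div_of_nonneg_right ?_ (by positivity))
    refine max_le (by norm_num) ?_
    rw [div_le_iff₀ (by norm_num)]; linarith
  · exact (h1 0 x hx).trans (abs_le.2 ⟨by linarith [hx.1], hx.2⟩)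
  · -- increments: `min(4|x|, (9/8)C₀/(8^l x²)) ≤ 28·2^{-l}` (split at `|x| = 7·2^{-l}`)
    have hinc : |(p (l + 1)).eval x - (p l).eval x| ≤ |(|x|) - (p (l + 1)).eval x| + |(|x|) - (p l).eval x| := by
      calc |(p (l + 1)).eval x - (p l).eval x| = |((|x|) - (p l).eval x) - ((|x|) - (p (l + 1)).eval x)| := by ring_nf
        _ ≤ |(|x|) - (p l).eval x| + |(|x|) - (p (l + 1)).eval x| := abs_sub _ _
        _ = _ := add_comm _ _
    by_cases hx0 : x = 0
    · have ha := h1 (l + 1) x hx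
      have hb := h1 l x hx
      rw [hx0, abs_zero] at ha hb
      have ea : (p (l + 1)).eval 0 = 0 := abs_nonpos_iff.1 ha
      have eb : (p l).eval 0 = 0 := abs_nonpos_iff.1 hb
      rw [hx0, ea, eb, sub_zero, abs_zero]; positivity
    have hA : |(p (l + 1)).eval x - (p l).eval x| ≤ 4 * |x| := by
      have := hinc.trans (add_le_add (h2 (l + 1) x hx) (h2 l x hx)); linarith
    have hB : |(p (l + 1)).eval x - (p l).eval x| ≤ (9 / 8 * (π ^ 7 / 3)) / (((2 : ℝ) ^ l) ^ 3 * |x| ^ 2) := by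
      have ha' := h3 (l + 1) x hx hx0
      have hb' := h3 l x hx hx0
      have e8 : ∀ m : ℕ, (8 : ℝ) ^ m * x ^ 2 = ((2 : ℝ) ^ m) ^ 3 * |x| ^ 2 := fun m => by
        rw [sq_abs, ← pow_mul, mul_comm m 3, pow_mul]; norm_num
      rw [e8] at ha' hb'
      have e2 : ((2 : ℝ) ^ (l + 1)) ^ 3 = 8 * ((2 : ℝ) ^ l) ^ 3 := by rw [pow_succ]; ring
      rw [e2] at ha'
      have hsum := hinc.trans (add_le_add ha' hb')
      have e : (π ^ 7 / 3) / (8 * ((2 : ℝ) ^ l) ^ 3 * |x| ^ 2) + (π ^ 7 / 3) / (((2 : ℝ) ^ l) ^ 3 * |x| ^ 2) =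
          (9 / 8 * (π ^ 7 / 3)) / (((2 : ℝ) ^ l) ^ 3 * |x| ^ 2) := by
        field_simp; ring
      rw [e] at hsum; exact hsum
    have key := le_of_two_profiles (by norm_num : (0 : ℝ) ≤ 4) (by positivity) (by norm_num : (0 : ℝ) < 7)
      (by positivity : (0 : ℝ) < 2 ^ l) hA hB
    refine key.trans (div_le_div_of_nonneg_right ?_ (by positivity))
    refine max_le (by norm_num) ?_
    rw [div_le_iff₀ (by norm_num)]; nlinarith [hC]
  · -- the cost: `deg(p_0) ≤ 1`, `deg(p_{l+1} − p_l) ≤ 2^{l+2} − 1 < 2^{l+2}`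
    have h0 : ((p 0).natDegree : ℝ) * 2 ≤ 2 := by
      have := hdeg 0
      have : ((p 0).natDegree : ℝ) ≤ 1 := by exact_mod_cast (by omega : (p 0).natDegree ≤ 1)
      linarith
    have hl : ∀ l : ℕ, ((p (l + 1) - p l).natDegree : ℝ) * (2 * (28 / 2 ^ l)) ≤ 224 := by
      intro l
      have e1 : 2 ^ (l + 2) = 2 * 2 ^ (l + 1) := by rw [Nat.pow_succ]; ring
      have e0 : 2 ^ (l + 1) = 2 * 2 ^ l := by rw [Nat.pow_succ]; ring
      have hd : (p (l + 1) - p l).natDegree ≤ 2 ^ (l + 2) := by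
        refine (Polynomial.natDegree_sub_le _ _).trans (max_le ?_ ?_)
        · have := hdeg (l + 1); omega
        · have := hdeg l; omega
      have hd' : ((p (l + 1) - p l).natDegree : ℝ) ≤ (2 : ℝ) ^ (l + 2) := by exact_mod_cast hd
      have h2l : (0 : ℝ) < 2 ^ l := by positivity
      calc ((p (l + 1) - p l).natDegree : ℝ) * (2 * (28 / 2 ^ l)) ≤ (2 : ℝ) ^ (l + 2) * (2 * (28 / 2 ^ l)) :=
            mul_le_mul_of_nonneg_right hd' (by positivity)
        _ = 224 := by rw [pow_add]; field_simp; ring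
    calc ((p 0).natDegree : ℝ) * 2 + ∑ l ∈ range J, ((p (l + 1) - p l).natDegree : ℝ) * (2 * (28 / 2 ^ l))
        ≤ 2 + ∑ _l ∈ range J, (224 : ℝ) := add_le_add h0 (Finset.sum_le_sum fun l _ => hl l)
      _ = 2 + 224 * J := by rw [Finset.sum_const, Finset.card_range, nsmul_eq_mul]; ring

end Summit.QuantumFields.YangMills.Theorems.BalabanUVNodesN19NoCheapDecompositionTight

end
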